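import Summits.NavierStokesRegularity.NavierStokesRegularity.Theses.AxisymmetricExtremality
import Summits.NavierStokesRegularity.NavierStokesRegularity.Theorems.AxisymmetricExtremalityMinimalDatumPFoldSplit
import Summits.NavierStokesRegularity.NavierStokesRegularity.Theorems.AxisymmetricExtremalityMinimalDatumPFoldOfSymmGap
import Summits.NavierStokesRegularity.NavierStokesRegularity.Theorems.AxisymmetricExtremalityMinimalDatumPFoldThresholdFinite
import Summits.NavierStokesRegularity.NavierStokesRegularity.Theorems.MinimalDatumPFold.Negative.VacuityAndLoadBearing

/-!
# Re-exam r1 (BC2 redirect) of crux `MinimalDatumPFold` (stmt-NavierStokesRegularity-15452) —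
# kernel-checked facts behind `STRATEGY-CENSUS.md` § Re-exam r1

Crux-strategist workfile (planner-cstrat-stmt-NavierStokesRegularity-15452-r1-0, 2026-08-17).
For each typed decomposition `X₁ ∧ … ∧ X_k → MinimalDatumPFold` examined in the census this file
records what the TREE already proves about it, sorry-free:

* §1 D1 (`SymmGapClosing ∧ SymmThresholdAttained`): child 2 is PROVED (`symmThresholdAttained`,
  landed) and child 1 is kernel-EQUIVALENT to the crux (`d1_child1_iff_crux`, both halves landed:
  `minimalDatumPFold_of_symmGapClosing`, `symmGapClosing_of_minimalDatumPFold`) — D1 violates (c)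
  ("no landed iff"): after the split the open leaf IS the crux.
* §2 D6 (2-adic tower): `TwoAdicStep → child 1 → crux` (`minimalDatumPFold_of_twoAdicStep`), the
  level-0 seed being the landed unfolding of the threshold
  (`exists_blowupDatum_norm_lt_of_thresholdFinite`) — ONE open piece above the crux, violates (a).
* §3 D7 (necklace split `PFoldBlowupExists ∧ SymmThresholdGapless`): glue PROVED
  (`minimalDatumPFold_of_exists_of_gapless`, via the landed `symmThresholdAttained` and
  `stub_thresholdFinite_of_clayFailure`); `X₁` is a consequence of the crux
  (`pFoldBlowupExists_of_minimalDatumPFold`) and of the summit (`pFoldBlowupExists_of_summit`).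
  Passes (a)(b)(c); fails (d) at `X₂` (census).
* §4 D9 (front-end split): the retired critical form (stmt-…-15303) is a single piece `≥` crux over
  the landed threshold finiteness (`minimalDatumPFold_of_criticalForm`) — violates (a)/(c).
-/

set_option linter.dupNamespace false
set_option linter.unusedVariables false

noncomputable section

open MeasureTheory Set Function Filter Topology
open scoped ENNReal

namespace Summit.NavierStokesRegularity.NavierStokesRegularity.Cruxes.MinimalDatumPFold.ReexamR1

open Literature.Analysis.FluidPDE Literature.Analysis.FunctionSpaces
open Summit.NavierStokesRegularity.NavierStokesRegularity.Theses.AxisymmetricExtremality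
open Summit.NavierStokesRegularity.NavierStokesRegularity.Theorems

local notation "ℝ³" => EuclideanSpace ℝ (Fin 3)
local notation "ℂ³" => EuclideanSpace ℂ (Fin 3)

/-! ## §0 Vocabulary (written so that everything bridges to the landed statements by `rfl`) -/

/-- Failure of Clay (A) at viscosity `ν` — verbatim the crux's antecedent. -/
def ClayFailsAt (ν : ℝ) : Prop :=
  ∃ v₀ : ℝ³ → ℝ³, ContDiff ℝ (⊤ : ℕ∞) v₀ ∧ NSWave0.IsDivFree v₀ ∧ HasRapidSpatialDecay v₀ ∧
    ¬ ∃ (u : ℝ → ℝ³ → ℝ³) (p : ℝ → ℝ³ → ℝ), IsSmoothOnHalfSpace u ∧ IsSmoothOnHalfSpace p ∧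
      IsNavierStokesSolution ν 0 v₀ u p ∧ HasBoundedEnergy u

/-- An a.e. `R_{2π/q}`-equivariant blow-up datum (`L³`, represented in `Ḣ^{1/2}`, weakly
divergence-free, no global Kato solution) of norm `< r`. -/
def SymmBlowupBelow (ν : ℝ) (q : ℝ) (r : ℝ≥0∞) : Prop :=
  ∃ (u₀ : ℝ³ → ℝ³) (g : HomSobolev ℝ³ ℂ³ (1 / 2 : ℝ)),
    MemLp u₀ 3 (volume : Measure ℝ³) ∧ g.Represents (EuclideanSpace.complexify ∘ u₀) ∧
      IsWeaklyDivFree u₀ ∧ ¬ HasGlobalKatoSolution ν u₀ ∧ ‖g‖ₑ < r ∧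
      ∀ᵐ x ∂(volume : Measure ℝ³), u₀ (WithLp.toLp 2 ![Real.cos (2 * Real.pi / q) * x 0 - Real.sin (2 * Real.pi / q) * x 1, Real.sin (2 * Real.pi / q) * x 0 + Real.cos (2 * Real.pi / q) * x 1, x 2]) = WithLp.toLp 2 ![Real.cos (2 * Real.pi / q) * u₀ x 0 - Real.sin (2 * Real.pi / q) * u₀ x 1, Real.sin (2 * Real.pi / q) * u₀ x 0 + Real.cos (2 * Real.pi / q) * u₀ x 1, u₀ x 2]

/-- An exactly `R_{2π/q}`-equivariant Rusin–Šverák MINIMAL blow-up datum. -/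
def SymmMinimal (ν : ℝ) (q : ℝ) : Prop :=
  ∃ (u₀ : ℝ³ → ℝ³) (g : HomSobolev ℝ³ ℂ³ (1 / 2 : ℝ)), IsMinimalBlowupDatum ν u₀ g ∧
    ∀ x : ℝ³, u₀ (WithLp.toLp 2 ![Real.cos (2 * Real.pi / q) * x 0 - Real.sin (2 * Real.pi / q) * x 1, Real.sin (2 * Real.pi / q) * x 0 + Real.cos (2 * Real.pi / q) * x 1, x 2]) = WithLp.toLp 2 ![Real.cos (2 * Real.pi / q) * u₀ x 0 - Real.sin (2 * Real.pi / q) * u₀ x 1, Real.sin (2 * Real.pi / q) * u₀ x 0 + Real.cos (2 * Real.pi / q) * u₀ x 1, u₀ x 2]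

/-- READ-BACK: the crux is `∀ ν > 0, ClayFailsAt ν → ∀ N, ∃ p ≥ max(N,2), SymmMinimal ν p`. -/
theorem crux_iff : MinimalDatumPFold ↔
    ∀ ν : ℝ, 0 < ν → ClayFailsAt ν → ∀ N : ℕ, ∃ p : ℕ, N ≤ p ∧ 2 ≤ p ∧ SymmMinimal ν (p : ℝ) :=
  Iff.rfl

/-! ## §1 D1 = `SymmGapClosing ∧ SymmThresholdAttained`: violates (c) -/

/-- Child 1 of D1 (`SymmGapClosing`, = registered stub `stub_symmGapClosing` of line `symmetric-gap`). -/
def D1Child1 : Prop :=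
  ∀ ν : ℝ, 0 < ν → ClayFailsAt ν → ∀ N : ℕ, ∃ p : ℕ, N ≤ p ∧ 2 ≤ p ∧
    ∀ ε : ℝ≥0∞, 0 < ε → SymmBlowupBelow ν (p : ℝ) (rusinSverakRhoMaxPure ν + ε)

/-- Child 2 of D1 (`SymmThresholdAttained`). -/
def D1Child2 : Prop :=
  ∀ ν : ℝ, 0 < ν → rusinSverakRhoMaxPure ν < ⊤ → ∀ p : ℕ, 2 ≤ p →
    (∀ ε : ℝ≥0∞, 0 < ε → SymmBlowupBelow ν (p : ℝ) (rusinSverakRhoMaxPure ν + ε)) → SymmMinimal ν (p : ℝ)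

/-- (b) the glue of D1 is landed (`minimalDatumPFold_of_subs`). [folklore] -/
theorem d1_glue_landed : D1Child1 → D1Child2 → MinimalDatumPFold :=
  fun h₁ h₂ => minimalDatumPFold_of_subs h₁ h₂

/-- Child 2 of D1 is PROVED in the tree (`symmThresholdAttained`, Theorems/…Split.lean). [folklore] -/
theorem d1_child2_proved : D1Child2 :=
  fun ν hν hfin p hp hfam => symmThresholdAttained ν hν hfin p hp hfam

/-- (c) FAILS for D1: child 1 is kernel-equivalent to the crux over the tree — both halves are
LANDED theorems (`minimalDatumPFold_of_symmGapClosing`, `symmGapClosing_of_minimalDatumPFold`). [folklore] -/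
theorem d1_child1_iff_crux : D1Child1 ↔ MinimalDatumPFold :=
  ⟨fun h => minimalDatumPFold_of_symmGapClosing h, fun h => symmGapClosing_of_minimalDatumPFold h⟩

/-! ## §2 D6 = the 2-adic tower: ONE open piece above the crux, violates (a) -/

/-- The Z/2-extremality STEP inside the `2^k`-fold symmetric class (census S3, typed there as
`CensusSketch.TwoAdicStep`): a `2^k`-fold a.e.-symmetric blow-up datum below level `r` ⇒
`2^(k+1)`-fold ones below `r + ε` for every `ε > 0`. -/
def TwoAdicStep : Prop :=
  ∀ ν : ℝ, 0 < ν → ∀ (k : ℕ) (r : ℝ≥0∞), SymmBlowupBelow ν ((2 ^ k : ℕ) : ℝ) r →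
    ∀ ε : ℝ≥0∞, 0 < ε → SymmBlowupBelow ν ((2 ^ (k + 1) : ℕ) : ℝ) (r + ε)

/-- Level `k = 0` (`1`-fold symmetry = no condition) is the landed unfolding of the threshold
(`exists_blowupDatum_norm_lt_of_thresholdFinite`): near-threshold blow-up data always exist. [folklore] -/
theorem symmBlowupBelow_level_zero {ν : ℝ} (hfin : rusinSverakRhoMaxPure ν < ⊤) {ε : ℝ≥0∞}
    (hε : 0 < ε) : SymmBlowupBelow ν ((2 ^ 0 : ℕ) : ℝ) (rusinSverakRhoMaxPure ν + ε) := by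
  obtain ⟨u₀, g, h1, h2, h3, h4, h5⟩ :=
    MinimalDatumPFold.Negative.exists_blowupDatum_norm_lt_of_thresholdFinite hfin hε
  refine ⟨u₀, g, h1, h2, h3, h4, h5, Eventually.of_forall fun x => ?_⟩
  have hrot : ∀ y : ℝ³, (WithLp.toLp 2 ![Real.cos (2 * Real.pi / ((2 ^ 0 : ℕ) : ℝ)) * y 0 - Real.sin (2 * Real.pi / ((2 ^ 0 : ℕ) : ℝ)) * y 1, Real.sin (2 * Real.pi / ((2 ^ 0 : ℕ) : ℝ)) * y 0 + Real.cos (2 * Real.pi / ((2 ^ 0 : ℕ) : ℝ)) * y 1, y 2] : ℝ³) = y := by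
    intro y
    ext i
    fin_cases i <;> simp [Real.cos_two_pi, Real.sin_two_pi]
  rw [hrot, hrot]

/-- Induction up the tower from the unrestricted threshold. [folklore] -/
theorem symmBlowupBelow_tower (hT : TwoAdicStep) {ν : ℝ} (hν : 0 < ν)
    (hfin : rusinSverakRhoMaxPure ν < ⊤) :
    ∀ k : ℕ, ∀ ε : ℝ≥0∞, 0 < ε → SymmBlowupBelow ν ((2 ^ k : ℕ) : ℝ) (rusinSverakRhoMaxPure ν + ε) := by
  intro k
  induction k with
  | zero => exact fun ε hε => symmBlowupBelow_level_zero hfin hε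
  | succ k ih =>
    intro ε hε
    have hε2 : 0 < ε / 2 := ENNReal.half_pos hε.ne'
    have h := hT ν hν k _ (ih (ε / 2) hε2) (ε / 2) hε2
    rwa [add_assoc, ENNReal.add_halves] at h

/-- `TwoAdicStep` alone gives child 1 of D1 (with `p = 2^(N+1)`) … [folklore] -/
theorem d1Child1_of_twoAdicStep (hT : TwoAdicStep) : D1Child1 := by
  intro ν hν hclay N
  have hfin : rusinSverakRhoMaxPure ν < ⊤ := stub_thresholdFinite_of_clayFailure ν hν hclay
  have hN : N ≤ 2 ^ (N + 1) :=
    (Nat.lt_two_pow_self).le.trans (Nat.pow_le_pow_right (by norm_num) (Nat.le_succ N))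
  have h2 : 2 ≤ 2 ^ (N + 1) := by
    calc (2 : ℕ) = 2 ^ 1 := by norm_num
      _ ≤ 2 ^ (N + 1) := Nat.pow_le_pow_right (by norm_num) (Nat.le_add_left 1 N)
  exact ⟨2 ^ (N + 1), hN, h2, fun ε hε => symmBlowupBelow_tower hT hν hfin (N + 1) ε hε⟩

/-- … hence the crux: the tower is a single strictly-stronger statement, not a decomposition. [folklore] -/
theorem minimalDatumPFold_of_twoAdicStep (hT : TwoAdicStep) : MinimalDatumPFold :=
  d1_child1_iff_crux.1 (d1Child1_of_twoAdicStep hT)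

/-! ## §3 D7 = `PFoldBlowupExists ∧ SymmThresholdGapless` (necklace split): glue PROVED -/

/-- `X₁` — symmetric blow-up EXISTS under Clay failure: for unboundedly many `p ≥ 2` some a.e.
`p`-fold symmetric critical datum has no global Kato solution (`ρ_p < ∞`; no minimality, no norm
bound). Open: robustness of blow-up under far-field (necklace) superposition. -/
def PFoldBlowupExists : Prop :=
  ∀ ν : ℝ, 0 < ν → ClayFailsAt ν → ∀ N : ℕ, ∃ p : ℕ, N ≤ p ∧ 2 ≤ p ∧ SymmBlowupBelow ν (p : ℝ) ⊤

/-- `X₂` — symmetric thresholds are GAPLESS (`ρ_p < ∞ ⇒ ρ_p = ρ_max`, infimum form): if some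
`p`-fold symmetric blow-up datum exists then `p`-fold symmetric blow-up data exist at every level
`ρ_max^pure ν + ε`. Open: the extremality of symmetry proper; NOT implied by the crux or the summit
(threshold-conditional, no Clay antecedent). -/
def SymmThresholdGapless : Prop :=
  ∀ ν : ℝ, 0 < ν → ∀ p : ℕ, 2 ≤ p → SymmBlowupBelow ν (p : ℝ) ⊤ →
    ∀ ε : ℝ≥0∞, 0 < ε → SymmBlowupBelow ν (p : ℝ) (rusinSverakRhoMaxPure ν + ε)

/-- (b) for D7: the glue `X₁ → X₂ → MinimalDatumPFold` is PROVED over the tree (landed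
`stub_thresholdFinite_of_clayFailure` + `symmThresholdAttained`). [folklore] -/
theorem minimalDatumPFold_of_exists_of_gapless (h₁ : PFoldBlowupExists) (h₂ : SymmThresholdGapless) :
    MinimalDatumPFold := by
  intro ν hν hclay N
  have hfin : rusinSverakRhoMaxPure ν < ⊤ := stub_thresholdFinite_of_clayFailure ν hν hclay
  obtain ⟨p, hNp, h2p, hex⟩ := h₁ ν hν hclay N
  obtain ⟨u₀, g, hmin, hsym⟩ := symmThresholdAttained ν hν hfin p h2p (h₂ ν hν p h2p hex)
  exact ⟨p, hNp, h2p, u₀, g, hmin, hsym⟩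

/-- `X₁` is a consequence of the crux (a minimal datum is a blow-up datum of finite norm). [folklore] -/
theorem pFoldBlowupExists_of_minimalDatumPFold (h : MinimalDatumPFold) : PFoldBlowupExists := by
  intro ν hν hclay N
  have hfin : rusinSverakRhoMaxPure ν < ⊤ := stub_thresholdFinite_of_clayFailure ν hν hclay
  obtain ⟨p, hNp, h2p, u₀, g, hmin, hsym⟩ := h ν hν hclay N
  refine ⟨p, hNp, h2p, u₀, g, hmin.1, hmin.2.1, hmin.2.2.1, hmin.2.2.2.2, ?_, Eventually.of_forall hsym⟩
  rw [hmin.2.2.2.1]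
  exact hfin

/-- … and (vacuously) of the summit, like the crux itself. [folklore] -/
theorem pFoldBlowupExists_of_summit (hS : NavierStokesRegularity) : PFoldBlowupExists :=
  pFoldBlowupExists_of_minimalDatumPFold (MinimalDatumPFold.Negative.cruxBody_of_navierStokesRegularity hS)

/-- `X₂ ∧ X₁ ⇒ child 1 of D1` (so D7 refines D1: it splits the crux-equivalent child 1 into an
existence half and a gap half). [folklore] -/
theorem d1Child1_of_exists_of_gapless (h₁ : PFoldBlowupExists) (h₂ : SymmThresholdGapless) : D1Child1 := by
  intro ν hν hclay N
  obtain ⟨p, hNp, h2p, hex⟩ := h₁ ν hν hclay N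
  exact ⟨p, hNp, h2p, h₂ ν hν p h2p hex⟩

/-! ## §4 D9 = front-end split: the retired critical form is a single piece ≥ crux -/

/-- The critical (threshold-conditional) form of the crux = the retired statement
stmt-NavierStokesRegularity-15303. -/
def CriticalForm : Prop :=
  ∀ ν : ℝ, 0 < ν → rusinSverakRhoMaxPure ν < ⊤ → ∀ N : ℕ, ∃ p : ℕ, N ≤ p ∧ 2 ≤ p ∧ SymmMinimal ν (p : ℝ)

/-- `CriticalForm → MinimalDatumPFold` over the landed front end: a one-piece "split". [folklore] -/
theorem minimalDatumPFold_of_criticalForm (h : CriticalForm) : MinimalDatumPFold :=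
  fun ν hν hclay N => h ν hν (stub_thresholdFinite_of_clayFailure ν hν hclay) N

end Summit.NavierStokesRegularity.NavierStokesRegularity.Cruxes.MinimalDatumPFold.ReexamR1

end
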